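import Mathlib.NumberTheory.SmoothNumbers
import Mathlib.Analysis.SpecialFunctions.Log.Basic
import Mathlib.Data.Nat.Squarefree
import HarnessLib

/-!
# Cell factorisation of friable squarefree integers (flexible factorisation at a prescribed threshold)

Topic `Literature/NumberTheory/Sieve`.  The elementary combinatorial device by which a level-of-
distribution estimate given in BILINEAR form `∑_m |∑_{n ~ N, (n,m)=1} b_n r(mn)|` (e.g. Iwaniec's
Corollary of Proposition 1 for `n² + 1`, level `x^{16/15}`) is applied to FRIABLE moduli with
arbitrary divisor-closed supports: a squarefree `y`-friable `d > A` factors uniquely as `d = n · m`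
where `n` collects the prime factors of `d` lying in the "cells" `⌊T log p⌋ ≤ k` for the least `k`
at which this partial product exceeds `A` (so `A < n ≤ A · (product of the primes of d in cell k)`),
and `m` collects the primes in the cells `> k`.  Grouping by `k` decouples the cross-condition
`P⁺(n) < P⁻(m)` of the greedy factorisation at the price of the `d` having two prime factors in one
cell (a proportion `≪ (log y)/T`).  The device ("condensation" of the prime factors into intervals,
then factorisation interval-wise) is the one of [cite: Greaves2001, Ch. 6, §6.1 and §6.1.1 Lemma 1]
(there for Rosser's weights); the friable case is folklore.  This file fixes one convenient version.

Definitions: `cell`, `lowPart`, `lowPartLT`, `lowSet`, `highSet`; basic API.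
-/

open Finset Real

noncomputable section

namespace Literature.NumberTheory.Sieve.FriableCell

/-- The **cell** of a positive integer `q` at resolution `T`: `⌊T · log q⌋₊`.  Two integers in the
same cell differ by a factor `< e^{1/T}`. [folklore] -/
def cell (T : ℝ) (q : ℕ) : ℕ := ⌊T * Real.log q⌋₊

/-- The **low part** of `d` at cell level `k`: the product of the prime factors of `d` whose cell is
`≤ k` (for squarefree `d`, its largest divisor composed of such primes). [folklore] -/
def lowPart (T : ℝ) (k : ℕ) (d : ℕ) : ℕ := ∏ p ∈ d.primeFactors.filter (fun p => cell T p ≤ k), p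

/-- The **strict low part** of `d` at cell level `k`: the product of the prime factors of `d` whose
cell is `< k`. [folklore] -/
def lowPartLT (T : ℝ) (k : ℕ) (d : ℕ) : ℕ := ∏ p ∈ d.primeFactors.filter (fun p => cell T p < k), p

/-- The **`n`-class at cell level `k`**: squarefree `n < N`, all prime factors `< Y` and in cells
`≤ k`, crossing the threshold `A` exactly at cell `k` (`lowPartLT k n ≤ A < n`). [folklore] -/
def lowSet (T A : ℝ) (Y N k : ℕ) : Finset ℕ :=
  (Finset.Ico 1 N).filter (fun n => Squarefree n ∧ (∀ p ∈ n.primeFactors, p < Y ∧ cell T p ≤ k) ∧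
    A < (n : ℝ) ∧ (lowPartLT T k n : ℝ) ≤ A)

/-- The **`m`-class at cell level `k`**: squarefree `m < M`, all prime factors `< Y` and in cells
`> k`. [folklore] -/
def highSet (T : ℝ) (Y M k : ℕ) : Finset ℕ :=
  (Finset.Ico 1 M).filter (fun m => Squarefree m ∧ ∀ p ∈ m.primeFactors, p < Y ∧ k < cell T p)

/-! ### Basic API -/

/-- Membership in `lowSet`, unfolded. [folklore] -/
theorem mem_lowSet {T A : ℝ} {Y N k n : ℕ} :
    n ∈ lowSet T A Y N k ↔ (1 ≤ n ∧ n < N) ∧ Squarefree n ∧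
      (∀ p ∈ n.primeFactors, p < Y ∧ cell T p ≤ k) ∧ A < (n : ℝ) ∧ (lowPartLT T k n : ℝ) ≤ A := by
  simp only [lowSet, Finset.mem_filter, Finset.mem_Ico]

/-- Membership in `highSet`, unfolded. [folklore] -/
theorem mem_highSet {T : ℝ} {Y M k m : ℕ} :
    m ∈ highSet T Y M k ↔ (1 ≤ m ∧ m < M) ∧ Squarefree m ∧
      ∀ p ∈ m.primeFactors, p < Y ∧ k < cell T p := by
  simp only [highSet, Finset.mem_filter, Finset.mem_Ico]

/-- `cell` is monotone. [folklore] -/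
theorem cell_mono (T : ℝ) (hT : 0 ≤ T) {a b : ℕ} (ha : 1 ≤ a) (hab : a ≤ b) : cell T a ≤ cell T b := by
  unfold cell
  refine Nat.floor_le_floor ?_
  refine mul_le_mul_of_nonneg_left (Real.log_le_log (by exact_mod_cast ha) (by exact_mod_cast hab)) hT

/-- Two positive integers in one cell differ by a factor `< e^{1/T}`. [folklore] -/
theorem lt_mul_exp_of_cell_eq {T : ℝ} (hT : 0 < T) {a b : ℕ} (ha : 1 ≤ a) (hb : 1 ≤ b)
    (h : cell T a = cell T b) : (b : ℝ) < a * Real.exp (1 / T) := by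
  unfold cell at h
  have ha0 : (0:ℝ) < a := by exact_mod_cast ha
  have hb0 : (0:ℝ) < b := by exact_mod_cast hb
  have hla : 0 ≤ T * Real.log a := mul_nonneg hT.le (Real.log_nonneg (by exact_mod_cast ha))
  have hlb : 0 ≤ T * Real.log b := mul_nonneg hT.le (Real.log_nonneg (by exact_mod_cast hb))
  have h1 : T * Real.log b < T * Real.log a + 1 := by
    have hfl := Nat.lt_floor_add_one (T * Real.log b)
    have hfa := Nat.floor_le hla
    rw [← h] at hfl
    linarith
  have h2 : Real.log b < Real.log a + 1 / T := by
    rw [div_eq_mul_inv, ← sub_lt_iff_lt_add']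
    have : T * (Real.log b - Real.log a) < 1 := by linarith
    calc Real.log b - Real.log a = (T * (Real.log b - Real.log a)) / T := by field_simp
      _ < 1 / T := by exact div_lt_div_of_pos_right this hT
      _ = 1 * T⁻¹ := by rw [div_eq_mul_inv]
  calc (b : ℝ) = Real.exp (Real.log b) := (Real.exp_log hb0).symm
    _ < Real.exp (Real.log a + 1 / T) := Real.exp_lt_exp.mpr h2
    _ = a * Real.exp (1 / T) := by rw [Real.exp_add, Real.exp_log ha0]

/-- A product of distinct primes dividing `d ≠ 0` divides `d`. [folklore] -/
theorem prod_filter_primeFactors_dvd (d : ℕ) (P : ℕ → Prop) [DecidablePred P] :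
    (∏ p ∈ d.primeFactors.filter P, p) ∣ d := by
  rcases eq_or_ne d 0 with rfl | hd
  · exact dvd_zero _
  exact (Finset.prod_dvd_prod_of_subset _ _ _ (Finset.filter_subset _ _)).trans
    (Nat.prod_primeFactors_dvd d)

/-- `lowPart k d ∣ d`. [folklore] -/
theorem lowPart_dvd (T : ℝ) (k d : ℕ) : lowPart T k d ∣ d :=
  prod_filter_primeFactors_dvd d _

/-- `lowPartLT k d ∣ d`. [folklore] -/
theorem lowPartLT_dvd (T : ℝ) (k d : ℕ) : lowPartLT T k d ∣ d :=
  prod_filter_primeFactors_dvd d _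

/-- `lowPart`, `lowPartLT` are positive. [folklore] -/
theorem lowPart_pos (T : ℝ) (k d : ℕ) : 0 < lowPart T k d :=
  Finset.prod_pos fun _ hp => (Nat.prime_of_mem_primeFactors (Finset.mem_filter.mp hp).1).pos

/-- `lowPartLT` is positive. [folklore] -/
theorem lowPartLT_pos (T : ℝ) (k d : ℕ) : 0 < lowPartLT T k d :=
  Finset.prod_pos fun _ hp => (Nat.prime_of_mem_primeFactors (Finset.mem_filter.mp hp).1).pos

/-- `lowPartLT 0 d = 1`. [folklore] -/
theorem lowPartLT_zero (T : ℝ) (d : ℕ) : lowPartLT T 0 d = 1 := by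
  unfold lowPartLT
  rw [Finset.filter_false_of_mem (fun p _ => Nat.not_lt_zero _), Finset.prod_empty]

/-- `lowPartLT (k+1) = lowPart k`. [folklore] -/
theorem lowPartLT_succ (T : ℝ) (k d : ℕ) : lowPartLT T (k + 1) d = lowPart T k d := by
  unfold lowPartLT lowPart
  congr 1
  exact Finset.filter_congr fun p _ => Nat.lt_succ_iff

/-- Monotonicity across levels: `lowPart k d ∣ lowPartLT k' d` for `k < k'`. [folklore] -/
theorem lowPart_dvd_lowPartLT (T : ℝ) {k k' : ℕ} (h : k < k') (d : ℕ) :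
    lowPart T k d ∣ lowPartLT T k' d := by
  unfold lowPart lowPartLT
  refine Finset.prod_dvd_prod_of_subset _ _ _ fun p hp => ?_
  rw [Finset.mem_filter] at hp ⊢
  exact ⟨hp.1, lt_of_le_of_lt hp.2 h⟩

/-- For squarefree `d` all of whose prime factors have cell `≤ k`, `lowPart k d = d`. [folklore] -/
theorem lowPart_eq_self {T : ℝ} {k d : ℕ} (hd : Squarefree d)
    (h : ∀ p ∈ d.primeFactors, cell T p ≤ k) : lowPart T k d = d := by
  unfold lowPart
  rw [Finset.filter_true_of_mem h]
  exact Nat.prod_primeFactors_of_squarefree hd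

/-! ### Products `n · m` of an `n`-class and an `m`-class element -/

/-- Elements of `lowSet k` and `highSet k` are coprime (their prime factors lie in disjoint cells).
[folklore] -/
theorem coprime_of_mem {T A : ℝ} {Y N M k n m : ℕ} (hn : n ∈ lowSet T A Y N k)
    (hm : m ∈ highSet T Y M k) : n.Coprime m := by
  rw [mem_lowSet] at hn
  rw [mem_highSet] at hm
  have hn0 : n ≠ 0 := by omega
  have hm0 : m ≠ 0 := by omega
  rw [← Nat.disjoint_primeFactors hn0 hm0, Finset.disjoint_left]
  intro p hpn hpm
  have h1 := (hn.2.2.1 p hpn).2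
  have h2 := (hm.2.2 p hpm).2
  omega

/-- `n · m` is squarefree. [folklore] -/
theorem squarefree_mul_of_mem {T A : ℝ} {Y N M k n m : ℕ} (hn : n ∈ lowSet T A Y N k)
    (hm : m ∈ highSet T Y M k) : Squarefree (n * m) :=
  Nat.squarefree_mul_iff.mpr ⟨coprime_of_mem hn hm, (mem_lowSet.mp hn).2.1, (mem_highSet.mp hm).2.1⟩

/-- The prime factors of `n · m`. [folklore] -/
theorem primeFactors_mul_of_mem {T A : ℝ} {Y N M k n m : ℕ} (hn : n ∈ lowSet T A Y N k)
    (hm : m ∈ highSet T Y M k) : (n * m).primeFactors = n.primeFactors ∪ m.primeFactors := by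
  have hn0 : n ≠ 0 := by have := (mem_lowSet.mp hn).1.1; omega
  have hm0 : m ≠ 0 := by have := (mem_highSet.mp hm).1.1; omega
  exact Nat.primeFactors_mul hn0 hm0

/-- Every prime factor of `n · m` is `< Y`. [folklore] -/
theorem prime_lt_of_mem_primeFactors_mul {T A : ℝ} {Y N M k n m : ℕ} (hn : n ∈ lowSet T A Y N k)
    (hm : m ∈ highSet T Y M k) {p : ℕ} (hp : p ∈ (n * m).primeFactors) : p < Y := by
  rw [primeFactors_mul_of_mem hn hm, Finset.mem_union] at hp
  rcases hp with hp | hp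
  · exact ((mem_lowSet.mp hn).2.2.1 p hp).1
  · exact ((mem_highSet.mp hm).2.2 p hp).1

/-- `n · m` is `Y`-friable (`∈ Nat.smoothNumbers Y`). [folklore] -/
theorem mul_mem_smoothNumbers {T A : ℝ} {Y N M k n m : ℕ} (hn : n ∈ lowSet T A Y N k)
    (hm : m ∈ highSet T Y M k) : n * m ∈ Nat.smoothNumbers Y := by
  have hn0 : n ≠ 0 := by have := (mem_lowSet.mp hn).1.1; omega
  have hm0 : m ≠ 0 := by have := (mem_highSet.mp hm).1.1; omega
  rw [Nat.mem_smoothNumbers']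
  intro p hp hpd
  exact prime_lt_of_mem_primeFactors_mul hn hm
    (Nat.mem_primeFactors.mpr ⟨hp, hpd, mul_ne_zero hn0 hm0⟩)

/-- **The low part of `n · m` at level `k` is `n`.** [folklore] -/
theorem lowPart_mul_of_mem {T A : ℝ} {Y N M k n m : ℕ} (hn : n ∈ lowSet T A Y N k)
    (hm : m ∈ highSet T Y M k) : lowPart T k (n * m) = n := by
  unfold lowPart
  have hfilter : (n * m).primeFactors.filter (fun p => cell T p ≤ k) = n.primeFactors := by
    rw [primeFactors_mul_of_mem hn hm, Finset.filter_union]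
    have h1 : n.primeFactors.filter (fun p => cell T p ≤ k) = n.primeFactors :=
      Finset.filter_true_of_mem fun p hp => ((mem_lowSet.mp hn).2.2.1 p hp).2
    have h2 : m.primeFactors.filter (fun p => cell T p ≤ k) = ∅ :=
      Finset.filter_false_of_mem fun p hp => not_le.mpr ((mem_highSet.mp hm).2.2 p hp).2
    rw [h1, h2, Finset.union_empty]
  rw [hfilter]
  exact Nat.prod_primeFactors_of_squarefree (mem_lowSet.mp hn).2.1

/-- **The strict low part of `n · m` at level `k` is that of `n`.** [folklore] -/
theorem lowPartLT_mul_of_mem {T A : ℝ} {Y N M k n m : ℕ} (hn : n ∈ lowSet T A Y N k)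
    (hm : m ∈ highSet T Y M k) : lowPartLT T k (n * m) = lowPartLT T k n := by
  unfold lowPartLT
  congr 1
  rw [primeFactors_mul_of_mem hn hm, Finset.filter_union]
  have h2 : m.primeFactors.filter (fun p => cell T p < k) = ∅ :=
    Finset.filter_false_of_mem fun p hp => not_lt.mpr ((mem_highSet.mp hm).2.2 p hp).2.le
  rw [h2, Finset.union_empty]

/-- For squarefree `d`: `lowPart k d · (product of the prime factors in cells > k) = d`. [folklore] -/
theorem lowPart_mul_prod_filter {T : ℝ} (k : ℕ) {d : ℕ} (hd : Squarefree d) :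
    lowPart T k d * ∏ p ∈ d.primeFactors.filter (fun p => ¬ cell T p ≤ k), p = d := by
  unfold lowPart
  rw [Finset.prod_filter_mul_prod_filter_not]
  exact Nat.prod_primeFactors_of_squarefree hd

/-- For squarefree `d`: `lowPartLT k d · (product of the prime factors in cell k) = lowPart k d`.
[folklore] -/
theorem lowPartLT_mul_prod_filter {T : ℝ} (k : ℕ) (d : ℕ) :
    lowPartLT T k d * ∏ p ∈ d.primeFactors.filter (fun p => cell T p = k), p = lowPart T k d := by
  unfold lowPart lowPartLT
  have hsplit : d.primeFactors.filter (fun p => cell T p ≤ k) =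
      (d.primeFactors.filter (fun p => cell T p < k)) ∪
        (d.primeFactors.filter (fun p => cell T p = k)) := by
    ext p
    simp only [Finset.mem_filter, Finset.mem_union]
    constructor
    · rintro ⟨hp, hle⟩
      rcases lt_or_eq_of_le hle with h | h
      · exact Or.inl ⟨hp, h⟩
      · exact Or.inr ⟨hp, h⟩
    · rintro (⟨hp, h⟩ | ⟨hp, h⟩)
      · exact ⟨hp, h.le⟩
      · exact ⟨hp, h.le⟩
  rw [hsplit, Finset.prod_union]
  exact Finset.disjoint_filter.mpr fun p _ h1 h2 => absurd h2 h1.ne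

/-- The prime factors of `lowPart k d` are the prime factors of `d` in cells `≤ k`. [folklore] -/
theorem primeFactors_lowPart (T : ℝ) (k d : ℕ) :
    (lowPart T k d).primeFactors = d.primeFactors.filter (fun p => cell T p ≤ k) :=
  Nat.primeFactors_prod fun _ hp => Nat.prime_of_mem_primeFactors (Finset.mem_filter.mp hp).1

/-- The prime factors of `lowPartLT k d` are the prime factors of `d` in cells `< k`. [folklore] -/
theorem primeFactors_lowPartLT (T : ℝ) (k d : ℕ) :
    (lowPartLT T k d).primeFactors = d.primeFactors.filter (fun p => cell T p < k) :=
  Nat.primeFactors_prod fun _ hp => Nat.prime_of_mem_primeFactors (Finset.mem_filter.mp hp).1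

/-- `lowPartLT k (lowPart k d) = lowPartLT k d`. [folklore] -/
theorem lowPartLT_lowPart (T : ℝ) (k d : ℕ) : lowPartLT T k (lowPart T k d) = lowPartLT T k d := by
  unfold lowPartLT
  rw [primeFactors_lowPart, Finset.filter_filter]
  congr 1
  exact Finset.filter_congr fun p _ => ⟨fun h => h.2, fun h => ⟨h.le, h⟩⟩

/-- `lowPart`, `lowPartLT` of a squarefree number are squarefree. [folklore] -/
theorem squarefree_lowPart (T : ℝ) (k : ℕ) {d : ℕ} (hd : Squarefree d) : Squarefree (lowPart T k d) :=
  hd.squarefree_of_dvd (lowPart_dvd T k d)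

end Literature.NumberTheory.Sieve.FriableCell

end
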